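import Summits.Ventures.AbcSig.Rows.XTemplateHalves
import Summits.Ventures.AbcSig.Levels.N3296

/-!
# Venture AbcSig — PARITY-HALF ROW `C2aL103A3yodd`: `xⁿ + 8·103^m·yⁿ = z²`, `y` odd (class `a = 3`, clean level only) over the NORM-FORM level file 3296 = 32·103 (GENERATED by p-lean g4 `gen4/halfrow.py`)

HONEST FRAMING. A row of a COMPUTATION cell (`pub-abcsig`); a CONDITIONAL theorem, no claim on ABC or any summit.
Hypotheses: `BS04Package` (CITED: [BS04] Lemma 3.3 + (3.1) + Lemma 4.2); `DataComplete 3296` + `RefinesCPSymAll 3296` (COMPUTED: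
certified engine-1 level file; norm-form certificates `Sieve/CharpolyCert.lean`, prime-ideal trees where the norm form is weaker);
the listed per-orbit exclusions `hX_…` (CITED: the row of record's module closures — nothing of them is checked here).
Only the parity half living at the single level 32·103 is claimed (the complementary half needs level 2·103, not certified).
Exponent range: prime `n ≥ 11`, `n ≠ 103`, n ∉ [11]; `1 ≤ m < n`.
Residual of record R = {11} EXCLUDED in the statement (hres). CITED per the row of record's R3: 3296.13 @ 13: M4/M6c-old; 3296.14 @ 13: M4/M6c-old.
Row of record: `census/rows/C2a/C2a-l103-a3-yodd.md` (sha16 `cde5bf3b3578a43c`; SIGNED 2026-08-22T16:05:08Z by referee (ref-g11)).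
-/

namespace Summit.Ventures.AbcSig

/-- Parity-half row `C2aL103A3yodd` (`xⁿ + 8·103^m·yⁿ = z²`, `y` odd (class `a = 3`, clean level only)); prime `n ≥ 11`, `n ≠ 103`, `n ∉ [11]`; conditional on the named hypotheses. -/
theorem xrow_C2aL103A3yodd (M : NewformModel) (hP : M.BS04Package)
    (hD3296 : M.DataComplete 3296 level3296Orbits) (hCP3296 : M.RefinesCPSymAll 3296 level3296CP)
    (n : ℕ) (hn : n.Prime) (hmin : 11 ≤ n) (hnℓ : n ≠ 103) (hres : n ∉ ([11] : List ℕ)) (m : ℕ) (hm : 1 ≤ m) (hmn : m < n)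
    (hX_orbit_3296_13 : n ∈ ([13] : List ℕ) → M.Excludes 3296 orbit_3296_13
      (famB (2 ^ 3 * 103 ^ m) n (fun _ _ => True)))
    (hX_orbit_3296_14 : n ∈ ([13] : List ℕ) → M.Excludes 3296 orbit_3296_14
      (famB (2 ^ 3 * 103 ^ m) n (fun _ _ => True)))
    (x y z : ℤ) (hy : ¬ 2 ∣ y) (hxy1 : x * y ≠ 1) (hxy2 : x * y ≠ -1) : ¬ IsPrimitiveSolution 1 (2 ^ 3 * 103 ^ m) 1 n x y z := by
  have hℓ : Nat.Prime 103 := by norm_num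
  have h7 : 7 ≤ n := by omega
  exact xrowC2a_a3_yodd 103 hℓ (by norm_num) M hP n hn h7 hnℓ hD3296 m hm hmn
    (level3296_sieve M hP hCP3296 n hn h7 (fun o => M.Excludes 3296 o
      (famB (2 ^ 3 * 103 ^ m) n (fun _ _ => True)) ∨ M.ExcludesStd 3296 o n) (fun _ h => Or.inr h) (fun hmem => by
      obtain rfl : n = 7 := by simpa using hmem
      omega) (fun hmem => by
      obtain rfl : n = 7 := by simpa using hmem
      omega) (fun hmem => by
      obtain rfl : n = 11 := by simpa using hmem
      exact absurd (by simp) hres) (fun hmem => by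
      obtain rfl : n = 11 := by simpa using hmem
      exact absurd (by simp) hres) (fun hmem => by
      obtain rfl : n = 13 := by simpa using hmem
      exact Or.inl (hX_orbit_3296_13 (by simp))) (fun hmem => by
      obtain rfl : n = 13 := by simpa using hmem
      exact Or.inl (hX_orbit_3296_14 (by simp))))
    x y z hy hxy1 hxy2

end Summit.Ventures.AbcSig
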